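import Literature.MathematicalPhysics.QuantumLattice.HubbardNNNHoppingWindowCertificateD4
import HarnessLib

/-!
# Sector-mode bootstrap / SOS certificates on a FINITE torus for the `t–t'` Hubbard model

Family `hubbard` (topic `MathematicalPhysics/QuantumLattice`); requested by the Hubbard-ladder cell
(LEAN REQUEST #39, R39.1). The tree's certificate theorems cover (a) window ("reduce"-mode)
certificates for the thermodynamic-limit energy density (`HubbardWindowCertificate*`,
`HubbardNNNHoppingWindowCertificate*`) and (b) finite-torus certificates with a RESTRICTED
constraint menu — Gram form, commutators `[H, X]` and the particle-number ideal
(`groundEnergy_hubbardRectTorusTT'_ge_of_certificate`), plus charged words at `t' = 0`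
(`groundEnergyAt_ge_of_certificate_charged`). This file states the soundness of a finite-torus
SECTOR-mode certificate with EVERY constraint class of X. Han's many-body bootstrap
(arXiv:2006.06002 §2 eq. (2)–(4): positivity `F[O†O] ≥ 0`; stationarity `F[[H, O]] = 0`;
discrete symmetries `F[U⁻¹ O U] = F[O]`, here the affine `D₄` group of the square torus generated
by the lattice translations and the point group; conserved charges `F[[C, O]] = 0`, `C ∈ {N̂, S^z}`,
i.e. vanishing of charged moments; the sector ideals `N̂ − N`, `S^z − M` of Rubin–Low–DePrince
§III.A) together with the two rounding classes of a rational certificate (anti-Hermitian parts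
`d • (Vᴴ − V)`, `d` real, of zero real expectation; residual ladder words, contractions, each
costing at most `‖a‖` — Kull–Schuch–Dive–Navascués §5.3):

* `minEnergyOn_szSector_ge_of_sector_certificate` — GENERIC: for any Hermitian `A` on the Fock
  space of a finite orbital lattice `Orb Λ` commuting with `N̂` and `S^z`, any non-trivial joint
  sector `K = szSector N M`, and any finite family of unitaries `Uₗ` commuting with `A` and (with
  their adjoints) preserving `K`, an identity
  `A − c·1 = Σ Λₐᵦ Oₐᴴ O_b + (Σₖ (A Xₖ − Xₖ A) + Σₗ (Uₗ Yₗ Uₗᴴ − Yₗ) + Σᵢ (Zᵢ (N̂ − N) + (N̂ − N) Z'ᵢ)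
     + Σᵢ (Sᵢ (S^z − M) + (S^z − M) S'ᵢ) + Σⱼ bⱼ • wⱼ) + (Σₘ dₘ • (Vₘᴴ − Vₘ) + Σₖ aₖ • vₖ)`
  with `Λ ⪰ 0`, CHARGED ladder words `wⱼ` (`ladderCharge wⱼ ≠ 0 ∨ ladderSpinCharge wⱼ ≠ 0`), real
  `dₘ` and ladder words `vₖ` proves `c − Σₖ ‖aₖ‖ ≤ minEnergyOn A K` — evaluation in the TRACIAL
  sector ground state `ω_P` (`Matrix.re_projState_ge_of_local_certificate`, `projState_self`),
  which is invariant under every symmetry of the sector problem (Han: "`ρ₀` … that also commutes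
  with all the charges `C_α` and `U_α`");
* `minEnergyOn_hubbardTorusTT'_ge_of_sector_certificate` — the `t–t'` torus
  `hubbardTorusTT' L t t' U` in the joint sector `(N, S^z = M)`, symmetry family the affine `D₄`
  unitaries `U_w D_γ = (fockTranslate w) (fockD4 γ)` (`d4Affine_mul_hubbardTorusTT'`);
* `groundEnergy_hubbardTorusTT'_ge_of_sector_certificate` — the sector `(2n, S^z = 0)`, where the
  `2n`-particle ground energy is attained (Lieb 1989): `c − Σₖ ‖aₖ‖ ≤ groundEnergy H (2n)`, the
  exact statement shape of a `certsdp/1(.1)` certificate with `hypotheses.mode = "sector"`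
  (bundle papers/HubbardSuperconductivity/manybody-bootstrap/FORMAT-certsdp1.md §3: objective
  `total`; `eom` rows ↦ `[H, X]`; `averaging.group` / symmetry identifications ↦ `U Y Uᴴ − Y`;
  ideals `N-<N>`, `2Sz-0` ↦ the two ideal families (the factor `2` is absorbed in `Sᵢ`);
  `zero_charge_moments` ↦ charged words; rounding ↦ the last two families; bound
  `E_cert = c − Σ |a|`);
* `groundEnergy_hubbardRectTorusTT'_ge_of_sector_certificate` — the rectangular torus
  `hubbardRectTorusTT' a b t t' U` with a user-supplied family of unitary symmetries (the tree has
  no Fock translation unitaries for `ℤ/aℤ × ℤ/bℤ` yet; `tt = ∅` is allowed);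
* `groundEnergyAt_fermionTorusGraph_ge_of_sector_certificate` — the case `t' = 0`
  (`hubbardTorusTT'_zero`): `c − Σₖ ‖aₖ‖ ≤ groundEnergyAt (fermionTorusGraph 2 L) t U (2n)`, the
  shape in which the `4 × 4` v2RDM / bootstrap lower bounds of Anderson et al. (2013) Table 1 and
  of the cell's inherited certificates enter the tree.

Everything is PROVED; no definition and no named fact is introduced (the `DecidableEq` instance on
torus sites is the file-local device of `HubbardTorusLocalCertificate`).

## References
* X. Han, *Quantum many-body bootstrap*, arXiv:2006.06002 (2020), §2 eq. (2)–(4) (constraint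
  classes; `E₀ ≥ E_lb` because the ground state functional commuting with all `C_α`, `U_α` is
  feasible), §3 (`C_α = {H, N, S_z}`, `U_α = {T_(1,0), T_(0,1), Π, R}`). [cite: Han2020Bootstrap, §2 eq. (2)–(4)]
* N. C. Rubin, G. H. Low, A. E. DePrince III, arXiv:2602.05069 (2026), §III.A (sum-of-squares
  certificates modulo the particle-number ideal). [cite: RubinLowDePrince2026, §III.A]
* I. Kull, N. Schuch, B. Dive, M. Navascués, PRX 14 (2024) 021008, §5.3 (rigorous rounding of SDP
  lower bounds). [cite: KullEtAl2024, §5.3]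
* J. S. M. Anderson, M. Nakata, R. Igarashi, K. Fujisawa, M. Yamashita, Comput. Theor. Chem. 1003
  (2013) 22–27 (v2RDM lower bounds for `4 × 4` Hubbard tori). [cite: AndersonNakataEtAl2013, Table 1]
* E. H. Lieb, PRL 62 (1989) 1201, proof of Theorem 1 (`S^z = 0` representatives). [cite: LiebPRL1989]
-/

noncomputable section

namespace Literature.MathematicalPhysics.QuantumLattice

open Matrix Finset Literature.Probability.LatticeModels
open Literature.MathematicalPhysics.QuantumManyBody.StateRelaxation
open scoped ComplexOrder

/-! ### Generic orbital lattices: any Hermitian operator conserving `N̂` and `S^z` -/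

section Generic

variable {Λ : Type*} [LinearOrder Λ] [Fintype Λ]

/-- **Sector-mode certificate, all constraint classes (generic).** Let `A` be a Hermitian operator
on the fermionic Fock space of the orbital lattice `Orb Λ` commuting with `N̂` and `S^z`, let
`K = szSector N M ≠ ⊥` be a joint sector, and let `Uₗ` (`l ∈ tt`) be unitaries commuting with `A`
which, with their adjoints, preserve `K`. An identity
`A − c·1 = Σ Λₐᵦ Oₐᴴ O_b + (Σₖ (A Xₖ − Xₖ A) + Σₗ (Uₗ Yₗ Uₗᴴ − Yₗ) + Σᵢ (Zᵢ (N̂ − N) + (N̂ − N) Z'ᵢ)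
  + Σᵢ (Sᵢ (S^z − M) + (S^z − M) S'ᵢ) + Σⱼ bⱼ • wⱼ) + (Σₘ dₘ • (Vₘᴴ − Vₘ) + Σₖ aₖ • vₖ)`
with `Λ ⪰ 0`, charged ladder words `wⱼ`, real `dₘ` and ladder words `vₖ` proves
`c − Σₖ ‖aₖ‖ ≤ minEnergyOn A K`: evaluate in the tracial ground state `ω_P` of `A` on `K`, which is
positive, normalised, kills commutators with `A`, is invariant under the `Uₗ`, annihilates the two
sector ideals and every charged word (a commutator with `N̂` or `S^z`,
`smul_ladderWord_eq_commutator_of_charged`), gives the anti-Hermitian parts zero real part and each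
contraction `vₖ` real part `≥ −‖aₖ‖`. Han 2020 §2 eq. (2)–(4); Rubin–Low–DePrince 2026 §III.A;
KSDN 2024 §5.3. [cite: Han2020Bootstrap, §2 eq. (2)–(4)] -/
theorem minEnergyOn_szSector_ge_of_sector_certificate
    (A : Matrix (Finset (Orb Λ)) (Finset (Orb Λ)) ℂ) (hA : A.IsHermitian)
    (hAN : Commute A totalNumber) (hAS : Commute A HubbardWave0.spinZ)
    {N : ℕ} {M : ℝ} (hK : (szSector N M : Submodule ℂ (Fock (Orb Λ))) ≠ ⊥)
    {m : Type*} [Fintype m] [DecidableEq m] {Λm : Matrix m m ℂ} (hΛm : Λm.PosSemidef)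
    (O : m → Matrix (Finset (Orb Λ)) (Finset (Orb Λ)) ℂ)
    {κ : Type*} (s : Finset κ) (Xc : κ → Matrix (Finset (Orb Λ)) (Finset (Orb Λ)) ℂ)
    {ι : Type*} (tt : Finset ι) (Us Y : ι → Matrix (Finset (Orb Λ)) (Finset (Orb Λ)) ℂ)
    (hU : ∀ l ∈ tt, Us l * A = A * Us l)
    (hUK : ∀ l ∈ tt, ∀ ψ ∈ (szSector N M : Submodule ℂ (Fock (Orb Λ))),
      Us l *ᵥ ψ ∈ (szSector N M : Submodule ℂ (Fock (Orb Λ))))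
    (hUK' : ∀ l ∈ tt, ∀ ψ ∈ (szSector N M : Submodule ℂ (Fock (Orb Λ))),
      (Us l)ᴴ *ᵥ ψ ∈ (szSector N M : Submodule ℂ (Fock (Orb Λ))))
    (hUU : ∀ l ∈ tt, (Us l)ᴴ * Us l = 1)
    {ρ : Type*} (r : Finset ρ) (Z Z' : ρ → Matrix (Finset (Orb Λ)) (Finset (Orb Λ)) ℂ)
    {ρ' : Type*} (r' : Finset ρ') (S S' : ρ' → Matrix (Finset (Orb Λ)) (Finset (Orb Λ)) ℂ)
    {γ : Type*} (u : Finset γ) (b : γ → ℂ) (cw : γ → List (Orb Λ × Bool))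
    (hcw : ∀ j ∈ u, ladderCharge (cw j) ≠ 0 ∨ ladderSpinCharge (cw j) ≠ 0)
    {δ : Type*} (ah : Finset δ) (dc : δ → ℝ) (V : δ → Matrix (Finset (Orb Λ)) (Finset (Orb Λ)) ℂ)
    {κ'' : Type*} (w : Finset κ'') (a : κ'' → ℂ) (word : κ'' → List (Orb Λ × Bool)) {c : ℝ}
    (hcert : A - (c : ℂ) • (1 : Matrix (Finset (Orb Λ)) (Finset (Orb Λ)) ℂ) =
      gramForm Λm O +
        (∑ k ∈ s, (A * Xc k - Xc k * A) + ∑ l ∈ tt, (Us l * Y l * (Us l)ᴴ - Y l) +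
          ∑ i ∈ r, (Z i * (totalNumber - (N : ℂ) • 1) + (totalNumber - (N : ℂ) • 1) * Z' i) +
          ∑ i ∈ r', (S i * (HubbardWave0.spinZ - (M : ℂ) • 1) +
            (HubbardWave0.spinZ - (M : ℂ) • 1) * S' i) +
          ∑ j ∈ u, b j • ladderWord (cw j)) +
        (∑ m' ∈ ah, ((dc m' : ℝ) : ℂ) • ((V m')ᴴ - V m') + ∑ k ∈ w, a k • ladderWord (word k))) :
    c - ∑ k ∈ w, ‖a k‖ ≤ A.minEnergyOn (szSector N M) := by
  set K : Submodule ℂ (Fock (Orb Λ)) := szSector N M with hKdef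
  have hKA : ∀ ψ ∈ K, A *ᵥ ψ ∈ K := fun ψ hψ => mulVec_mem_szSector_of_commute hAN hAS hψ
  -- the two sector ideals as one `Q = q` family over `ρ ⊕ ρ'`
  set Q : ρ ⊕ ρ' → Matrix (Finset (Orb Λ)) (Finset (Orb Λ)) ℂ :=
    Sum.elim (fun _ => totalNumber) (fun _ => HubbardWave0.spinZ) with hQ
  set q : ρ ⊕ ρ' → ℝ := Sum.elim (fun _ => (N : ℝ)) (fun _ => M) with hq
  set ZZ : ρ ⊕ ρ' → Matrix (Finset (Orb Λ)) (Finset (Orb Λ)) ℂ := Sum.elim Z S with hZZ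
  set ZZ' : ρ ⊕ ρ' → Matrix (Finset (Orb Λ)) (Finset (Orb Λ)) ℂ := Sum.elim Z' S' with hZZ'
  have hNh : (totalNumber : Matrix (Finset (Orb Λ)) (Finset (Orb Λ)) ℂ)ᴴ = totalNumber := by
    rw [totalNumber_eq_numberDiag_univ]
    exact numberDiag_conjTranspose _
  have hQh : ∀ i ∈ r.disjSum r', (Q i).IsHermitian := by
    rintro (i | i) _
    · exact hNh
    · exact HubbardWave0.spinZ_isHermitian
  have hQq : ∀ i ∈ r.disjSum r', ∀ ψ ∈ K, Q i *ᵥ ψ = ((q i : ℝ) : ℂ) • ψ := by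
    rintro (i | i) _ ψ hψ
    · obtain ⟨hNψ, -⟩ := (mem_szSector_iff _ _ ψ).1 hψ
      show totalNumber *ᵥ ψ = (((N : ℕ) : ℝ) : ℂ) • ψ
      rw [totalNumber_mulVec_of_isNParticle hNψ, Complex.ofReal_natCast]
    · obtain ⟨-, hSψ⟩ := (mem_szSector_iff _ _ ψ).1 hψ
      exact hSψ
  -- charged words as commutators with `N̂` / `S^z`
  set C : γ → Matrix (Finset (Orb Λ)) (Finset (Orb Λ)) ℂ :=
    fun j => if ladderCharge (cw j) ≠ 0 then totalNumber else HubbardWave0.spinZ with hC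
  set W : γ → Matrix (Finset (Orb Λ)) (Finset (Orb Λ)) ℂ :=
    fun j => (b j / (if ladderCharge (cw j) ≠ 0 then ((ladderCharge (cw j) : ℤ) : ℂ)
      else ((ladderSpinCharge (cw j) : ℤ) : ℂ) / 2)) • ladderWord (cw j) with hW
  have hC1 : ∀ j ∈ u, C j * A = A * C j := by
    intro j _
    by_cases hq : ladderCharge (cw j) ≠ 0
    · simp only [hC, hq, ne_eq, not_false_eq_true, if_true]; exact hAN.symm.eq
    · simp only [hC, hq, if_false]; exact hAS.symm.eq
  have hCK : ∀ j ∈ u, ∀ ψ ∈ K, C j *ᵥ ψ ∈ K := by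
    intro j _ ψ hψ
    obtain ⟨hNψ, hSψ⟩ := (mem_szSector_iff _ _ ψ).1 hψ
    by_cases hq : ladderCharge (cw j) ≠ 0
    · simp only [hC, hq, ne_eq, not_false_eq_true, if_true]
      rw [totalNumber_mulVec_of_isNParticle hNψ]
      exact Submodule.smul_mem _ _ hψ
    · simp only [hC, hq, if_false]
      rw [hSψ]
      exact Submodule.smul_mem _ _ hψ
  have hCh : ∀ j, (C j)ᴴ = C j := by
    intro j
    by_cases hq : ladderCharge (cw j) ≠ 0
    · simp only [hC, hq, ne_eq, not_false_eq_true, if_true]; exact hNh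
    · simp only [hC, hq, if_false]; exact HubbardWave0.spinZ_isHermitian.eq
  have hCK' : ∀ j ∈ u, ∀ ψ ∈ K, (C j)ᴴ *ᵥ ψ ∈ K := fun j hj ψ hψ => by
    rw [hCh j]; exact hCK j hj ψ hψ
  have hcharged : ∀ j ∈ u, C j * W j - W j * C j = b j • ladderWord (cw j) := fun j hj =>
    (smul_ladderWord_eq_commutator_of_charged (b j) (cw j) (hcw j hj)).symm
  -- residual words are contractions
  have hMc : ∀ k ∈ w, (ladderWord (word k)).IsContraction := fun k _ => by
    rw [ladderWord_eq_prod]; exact isContraction_prod_ladder _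
  -- the identity in the shape of `Matrix.re_projState_ge_of_local_certificate`
  have hmid : ∑ k ∈ s, (A * Xc k - Xc k * A) + ∑ l ∈ tt, (Us l * Y l * (Us l)ᴴ - Y l) +
        ∑ i ∈ r.disjSum r', (ZZ i * (Q i - ((q i : ℝ) : ℂ) • 1) + (Q i - ((q i : ℝ) : ℂ) • 1) * ZZ' i) +
        ∑ j ∈ u, (C j * W j - W j * C j) =
      ∑ k ∈ s, (A * Xc k - Xc k * A) + ∑ l ∈ tt, (Us l * Y l * (Us l)ᴴ - Y l) +
        ∑ i ∈ r, (Z i * (totalNumber - (N : ℂ) • 1) + (totalNumber - (N : ℂ) • 1) * Z' i) +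
        ∑ i ∈ r', (S i * (HubbardWave0.spinZ - (M : ℂ) • 1) +
          (HubbardWave0.spinZ - (M : ℂ) • 1) * S' i) +
        ∑ j ∈ u, b j • ladderWord (cw j) := by
    rw [Finset.sum_disjSum, Finset.sum_congr rfl hcharged]
    simp only [hZZ, hZZ', hQ, hq, Sum.elim_inl, Sum.elim_inr, Complex.ofReal_natCast]
    abel
  have hcert' : A - (c : ℂ) • (1 : Matrix (Finset (Orb Λ)) (Finset (Orb Λ)) ℂ) =
      gramForm Λm O +
        (∑ k ∈ s, (A * Xc k - Xc k * A) + ∑ l ∈ tt, (Us l * Y l * (Us l)ᴴ - Y l) +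
          ∑ i ∈ r.disjSum r', (ZZ i * (Q i - ((q i : ℝ) : ℂ) • 1) + (Q i - ((q i : ℝ) : ℂ) • 1) * ZZ' i) +
          ∑ j ∈ u, (C j * W j - W j * C j)) +
        (∑ m' ∈ ah, ((dc m' : ℝ) : ℂ) • ((V m')ᴴ - V m') + ∑ k ∈ w, a k • ladderWord (word k)) := by
    rw [hmid]; exact hcert
  have h := Matrix.re_projState_ge_of_local_certificate hA K hKA hK A hΛm O s Xc tt Us Y hU hUK hUK'
    hUU (r.disjSum r') Q ZZ ZZ' q hQh hQq u C W hC1 hCK hCK' ah dc V w a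
    (fun k => ladderWord (word k)) hMc hcert'
  -- `ω_P(A) = minEnergyOn A K`
  rw [projState_self (sectorGroundProj_isHermitian A K) (sectorGroundProj_mul_self A K)
    (sectorGroundProj_ne_zero hA K hKA hK) (sectorGroundProj_mul hA K), Complex.ofReal_re] at h
  exact h

end Generic

/-! ### The `t–t'` Hubbard torus -/

section Torus

variable {L : ℕ} [NeZero L]

/-- (Local to this file, as in `HubbardTorusLocalCertificate` / `HubbardWindowCertificateD4`.) Torus
sites are compared through the linear order, the instance carried by the orbital-generic lemmas.
[folklore] -/
local instance (priority := high) instDecidableEqFermionTorusSector : DecidableEq (FermionTorus 2 L) :=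
  LinearOrder.toDecidableEq

/-- **Sector-mode certificate for the `t–t'` torus in the joint sector `(N, S^z = M)`**, symmetry
family the affine `D₄` unitaries `U_{wₗ} D_{γₗ} = (fockTranslate wₗ) (fockD4 γₗ)` of the square torus
(`γₗ = 1`: pure translations), which commute with `hubbardTorusTT' L t t' U` and preserve every
joint sector: the identity of `minEnergyOn_szSector_ge_of_sector_certificate` with
`A = hubbardTorusTT' L t t' U` proves `c − Σₖ ‖aₖ‖ ≤ minEnergyOn H (szSector N M)` whenever that
sector is non-trivial. Han 2020 §3 (`C_α = {H, N, S_z}`, `U_α = {T_(1,0), T_(0,1), Π, R}`).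
[cite: Han2020Bootstrap, §3] -/
theorem minEnergyOn_hubbardTorusTT'_ge_of_sector_certificate (t t' U : ℝ) {N : ℕ} {M : ℝ}
    (hK : (szSector N M : Submodule ℂ (Fock (Orb (FermionTorus 2 L)))) ≠ ⊥)
    {m : Type*} [Fintype m] [DecidableEq m] {Λm : Matrix m m ℂ} (hΛm : Λm.PosSemidef)
    (O : m → Matrix (Finset (Orb (FermionTorus 2 L))) (Finset (Orb (FermionTorus 2 L))) ℂ)
    {κ : Type*} (s : Finset κ)
    (Xc : κ → Matrix (Finset (Orb (FermionTorus 2 L))) (Finset (Orb (FermionTorus 2 L))) ℂ)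
    {ι : Type*} (tt : Finset ι) (γ : ι → DihedralGroup 4) (wv : ι → TorusSite 2 L)
    (Y : ι → Matrix (Finset (Orb (FermionTorus 2 L))) (Finset (Orb (FermionTorus 2 L))) ℂ)
    {ρ : Type*} (r : Finset ρ)
    (Z Z' : ρ → Matrix (Finset (Orb (FermionTorus 2 L))) (Finset (Orb (FermionTorus 2 L))) ℂ)
    {ρ' : Type*} (r' : Finset ρ')
    (S S' : ρ' → Matrix (Finset (Orb (FermionTorus 2 L))) (Finset (Orb (FermionTorus 2 L))) ℂ)
    {ρ'' : Type*} (u : Finset ρ'') (b : ρ'' → ℂ) (cw : ρ'' → List (Orb (FermionTorus 2 L) × Bool))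
    (hcw : ∀ j ∈ u, ladderCharge (cw j) ≠ 0 ∨ ladderSpinCharge (cw j) ≠ 0)
    {δ : Type*} (ah : Finset δ) (dc : δ → ℝ)
    (V : δ → Matrix (Finset (Orb (FermionTorus 2 L))) (Finset (Orb (FermionTorus 2 L))) ℂ)
    {κ'' : Type*} (w : Finset κ'') (a : κ'' → ℂ) (word : κ'' → List (Orb (FermionTorus 2 L) × Bool))
    {c : ℝ}
    (hcert : hubbardTorusTT' L t t' U -
        (c : ℂ) • (1 : Matrix (Finset (Orb (FermionTorus 2 L))) (Finset (Orb (FermionTorus 2 L))) ℂ) =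
      gramForm Λm O +
        (∑ k ∈ s, (hubbardTorusTT' L t t' U * Xc k - Xc k * hubbardTorusTT' L t t' U) +
          ∑ l ∈ tt, ((fockTranslate (wv l)).val * (fockD4 (L := L) (γ l)).val * Y l *
              ((fockTranslate (wv l)).val * (fockD4 (L := L) (γ l)).val)ᴴ - Y l) +
          ∑ i ∈ r, (Z i * (totalNumber - (N : ℂ) • 1) + (totalNumber - (N : ℂ) • 1) * Z' i) +
          ∑ i ∈ r', (S i * (HubbardWave0.spinZ - (M : ℂ) • 1) +
            (HubbardWave0.spinZ - (M : ℂ) • 1) * S' i) +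
          ∑ j ∈ u, b j • ladderWord (cw j)) +
        (∑ m' ∈ ah, ((dc m' : ℝ) : ℂ) • ((V m')ᴴ - V m') + ∑ k ∈ w, a k • ladderWord (word k))) :
    c - ∑ k ∈ w, ‖a k‖ ≤ (hubbardTorusTT' L t t' U).minEnergyOn (szSector N M) :=
  minEnergyOn_szSector_ge_of_sector_certificate (hubbardTorusTT' L t t' U)
    (hubbardTorusTT'_isHermitian L t t' U) (hubbardTorusTT'_commute_totalNumber L t t' U)
    (hubbardTorusTT'_commute_spinZ L t t' U) hK hΛm O s Xc tt
    (fun l => (fockTranslate (wv l)).val * (fockD4 (L := L) (γ l)).val) Y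
    (fun l _ => d4Affine_mul_hubbardTorusTT' (γ l) (wv l) t t' U)
    (fun l _ _ hψ => d4Affine_mulVec_mem_szSector (γ l) (wv l) hψ)
    (fun l _ _ hψ => d4Affine_conjTranspose_mulVec_mem_szSector (γ l) (wv l) hψ)
    (fun l _ => d4Affine_conjTranspose_mul_self (γ l) (wv l))
    r Z Z' r' S S' u b cw hcw ah dc V w a word hcert

/-- **Sector-mode certificate ⇒ lower bound on the `2n`-particle ground energy of the `t–t'`
torus.** In the sector `(2n, S^z = 0)` (`n ≤ L²`), where the `2n`-particle ground energy is
attained (`groundEnergy_hubbardTorusTT'_eq_minEnergyOn_szSector`, Lieb 1989), an identity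
`H − c·1 = Σ Λₐᵦ Oₐᴴ O_b + (Σₖ (H Xₖ − Xₖ H) + Σₗ (Uₗ Yₗ Uₗᴴ − Yₗ) + Σᵢ (Zᵢ (N̂ − 2n) + (N̂ − 2n) Z'ᵢ)
  + Σᵢ (Sᵢ S^z + S^z S'ᵢ) + Σⱼ bⱼ • wⱼ) + (Σₘ dₘ • (Vₘᴴ − Vₘ) + Σₖ aₖ • vₖ)`,
`H = hubbardTorusTT' L t t' U`, `Uₗ = (fockTranslate wₗ)(fockD4 γₗ)`, `Λ ⪰ 0`, charged ladder words
`wⱼ`, real `dₘ`, ladder words `vₖ`, proves `c − Σₖ ‖aₖ‖ ≤ groundEnergy H (2n)`. This is the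
soundness statement of a `certsdp/1` SECTOR-mode certificate (all multiplier classes: Gram block,
`eom`, symmetry identifications, ideals `N̂ − N` and `2S^z`, `zero_charge_moments`, rounding
residual; `E_cert = c − Σ |a|`). Han 2020 §2 eq. (2)–(4), §3; Rubin–Low–DePrince 2026 §III.A;
KSDN 2024 §5.3. [cite: Han2020Bootstrap, §2 eq. (2)–(4)] -/
theorem groundEnergy_hubbardTorusTT'_ge_of_sector_certificate (t t' U : ℝ) {nh : ℕ}
    (hn : nh ≤ Fintype.card (FermionTorus 2 L))
    {m : Type*} [Fintype m] [DecidableEq m] {Λm : Matrix m m ℂ} (hΛm : Λm.PosSemidef)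
    (O : m → Matrix (Finset (Orb (FermionTorus 2 L))) (Finset (Orb (FermionTorus 2 L))) ℂ)
    {κ : Type*} (s : Finset κ)
    (Xc : κ → Matrix (Finset (Orb (FermionTorus 2 L))) (Finset (Orb (FermionTorus 2 L))) ℂ)
    {ι : Type*} (tt : Finset ι) (γ : ι → DihedralGroup 4) (wv : ι → TorusSite 2 L)
    (Y : ι → Matrix (Finset (Orb (FermionTorus 2 L))) (Finset (Orb (FermionTorus 2 L))) ℂ)
    {ρ : Type*} (r : Finset ρ)
    (Z Z' : ρ → Matrix (Finset (Orb (FermionTorus 2 L))) (Finset (Orb (FermionTorus 2 L))) ℂ)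
    {ρ' : Type*} (r' : Finset ρ')
    (S S' : ρ' → Matrix (Finset (Orb (FermionTorus 2 L))) (Finset (Orb (FermionTorus 2 L))) ℂ)
    {ρ'' : Type*} (u : Finset ρ'') (b : ρ'' → ℂ) (cw : ρ'' → List (Orb (FermionTorus 2 L) × Bool))
    (hcw : ∀ j ∈ u, ladderCharge (cw j) ≠ 0 ∨ ladderSpinCharge (cw j) ≠ 0)
    {δ : Type*} (ah : Finset δ) (dc : δ → ℝ)
    (V : δ → Matrix (Finset (Orb (FermionTorus 2 L))) (Finset (Orb (FermionTorus 2 L))) ℂ)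
    {κ'' : Type*} (w : Finset κ'') (a : κ'' → ℂ) (word : κ'' → List (Orb (FermionTorus 2 L) × Bool))
    {c : ℝ}
    (hcert : hubbardTorusTT' L t t' U -
        (c : ℂ) • (1 : Matrix (Finset (Orb (FermionTorus 2 L))) (Finset (Orb (FermionTorus 2 L))) ℂ) =
      gramForm Λm O +
        (∑ k ∈ s, (hubbardTorusTT' L t t' U * Xc k - Xc k * hubbardTorusTT' L t t' U) +
          ∑ l ∈ tt, ((fockTranslate (wv l)).val * (fockD4 (L := L) (γ l)).val * Y l *
              ((fockTranslate (wv l)).val * (fockD4 (L := L) (γ l)).val)ᴴ - Y l) +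
          ∑ i ∈ r, (Z i * (totalNumber - ((2 * nh : ℕ) : ℂ) • 1) +
            (totalNumber - ((2 * nh : ℕ) : ℂ) • 1) * Z' i) +
          ∑ i ∈ r', (S i * HubbardWave0.spinZ + HubbardWave0.spinZ * S' i) +
          ∑ j ∈ u, b j • ladderWord (cw j)) +
        (∑ m' ∈ ah, ((dc m' : ℝ) : ℂ) • ((V m')ᴴ - V m') + ∑ k ∈ w, a k • ladderWord (word k))) :
    c - ∑ k ∈ w, ‖a k‖ ≤ groundEnergy (hubbardTorusTT' L t t' U) (2 * nh) := by
  rw [groundEnergy_hubbardTorusTT'_eq_minEnergyOn_szSector L t t' U hn]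
  refine minEnergyOn_hubbardTorusTT'_ge_of_sector_certificate t t' U (szSector_ne_bot 0 0 hn) hΛm O s
    Xc tt γ wv Y r Z Z' r' S S' u b cw hcw ah dc V w a word ?_
  simpa only [Complex.ofReal_zero, zero_smul, sub_zero] using hcert

/-- **The case `t' = 0`**: a sector-mode certificate for the pure Hubbard torus
`hubbardTorus 2 L t U = hamiltonian (fermionTorusGraph 2 L) t U` (same multiplier classes, same
affine-`D₄` symmetry family) proves `c − Σₖ ‖aₖ‖ ≤ groundEnergyAt (fermionTorusGraph 2 L) t U (2n)`
— the statement shape of the rigorous `4 × 4` lower bounds of Anderson et al. (2013) Table 1 and of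
a `certsdp/1` sector-mode certificate at `t' = 0`. Han 2020 §3; Anderson–Nakata–Igarashi–
Fujisawa–Yamashita 2013. [cite: Han2020Bootstrap, §3] -/
theorem groundEnergyAt_fermionTorusGraph_ge_of_sector_certificate (t U : ℝ) {nh : ℕ}
    (hn : nh ≤ Fintype.card (FermionTorus 2 L))
    {m : Type*} [Fintype m] [DecidableEq m] {Λm : Matrix m m ℂ} (hΛm : Λm.PosSemidef)
    (O : m → Matrix (Finset (Orb (FermionTorus 2 L))) (Finset (Orb (FermionTorus 2 L))) ℂ)
    {κ : Type*} (s : Finset κ)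
    (Xc : κ → Matrix (Finset (Orb (FermionTorus 2 L))) (Finset (Orb (FermionTorus 2 L))) ℂ)
    {ι : Type*} (tt : Finset ι) (γ : ι → DihedralGroup 4) (wv : ι → TorusSite 2 L)
    (Y : ι → Matrix (Finset (Orb (FermionTorus 2 L))) (Finset (Orb (FermionTorus 2 L))) ℂ)
    {ρ : Type*} (r : Finset ρ)
    (Z Z' : ρ → Matrix (Finset (Orb (FermionTorus 2 L))) (Finset (Orb (FermionTorus 2 L))) ℂ)
    {ρ' : Type*} (r' : Finset ρ')
    (S S' : ρ' → Matrix (Finset (Orb (FermionTorus 2 L))) (Finset (Orb (FermionTorus 2 L))) ℂ)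
    {ρ'' : Type*} (u : Finset ρ'') (b : ρ'' → ℂ) (cw : ρ'' → List (Orb (FermionTorus 2 L) × Bool))
    (hcw : ∀ j ∈ u, ladderCharge (cw j) ≠ 0 ∨ ladderSpinCharge (cw j) ≠ 0)
    {δ : Type*} (ah : Finset δ) (dc : δ → ℝ)
    (V : δ → Matrix (Finset (Orb (FermionTorus 2 L))) (Finset (Orb (FermionTorus 2 L))) ℂ)
    {κ'' : Type*} (w : Finset κ'') (a : κ'' → ℂ) (word : κ'' → List (Orb (FermionTorus 2 L) × Bool))
    {c : ℝ}
    (hcert : hubbardTorus 2 L t U -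
        (c : ℂ) • (1 : Matrix (Finset (Orb (FermionTorus 2 L))) (Finset (Orb (FermionTorus 2 L))) ℂ) =
      gramForm Λm O +
        (∑ k ∈ s, (hubbardTorus 2 L t U * Xc k - Xc k * hubbardTorus 2 L t U) +
          ∑ l ∈ tt, ((fockTranslate (wv l)).val * (fockD4 (L := L) (γ l)).val * Y l *
              ((fockTranslate (wv l)).val * (fockD4 (L := L) (γ l)).val)ᴴ - Y l) +
          ∑ i ∈ r, (Z i * (totalNumber - ((2 * nh : ℕ) : ℂ) • 1) +
            (totalNumber - ((2 * nh : ℕ) : ℂ) • 1) * Z' i) +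
          ∑ i ∈ r', (S i * HubbardWave0.spinZ + HubbardWave0.spinZ * S' i) +
          ∑ j ∈ u, b j • ladderWord (cw j)) +
        (∑ m' ∈ ah, ((dc m' : ℝ) : ℂ) • ((V m')ᴴ - V m') + ∑ k ∈ w, a k • ladderWord (word k))) :
    c - ∑ k ∈ w, ‖a k‖ ≤ groundEnergyAt (fermionTorusGraph 2 L) t U (2 * nh) := by
  have h := groundEnergy_hubbardTorusTT'_ge_of_sector_certificate t 0 U hn hΛm O s Xc tt γ wv Y r Z Z'
    r' S S' u b cw hcw ah dc V w a word (by rw [hubbardTorusTT'_zero]; exact hcert)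
  rw [hubbardTorusTT'_zero] at h
  exact h

end Torus

/-! ### The rectangular `t–t'` torus `ℤ/aℤ × ℤ/bℤ` -/

section Rect

variable {La Lb : ℕ}

/-- (Local to this file.) Rectangular-torus sites are compared through the lexicographic linear
order, the instance carried by the orbital-generic lemmas. [folklore] -/
local instance (priority := high) instDecidableEqRectSector : DecidableEq (Fin La ×ₗ Fin Lb) :=
  LinearOrder.toDecidableEq

/-- **Sector-mode certificate ⇒ lower bound on the `2n`-particle ground energy of the rectangular
`t–t'` torus** `hubbardRectTorusTT' La Lb t t' U` (`n ≤ La·Lb`), with a user-supplied family of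
unitary symmetries `Uₗ` (commuting with `H`; `Uₗ`, `Uₗᴴ` preserving the sector `(2n, S^z = 0)`;
`Uₗᴴ Uₗ = 1` — e.g. none): the same identity as in
`groundEnergy_hubbardTorusTT'_ge_of_sector_certificate` proves `c − Σₖ ‖aₖ‖ ≤ groundEnergy H (2n)`.
Extends `groundEnergy_hubbardRectTorusTT'_ge_of_certificate` (Gram + `[H, X]` + `N̂`-ideal only)
by the `S^z` ideal, symmetries, charged words and the rounding residual. Han 2020 §2 eq. (2)–(4);
LeBlanc et al. 2015 eq. (1). [cite: Han2020Bootstrap, §2 eq. (2)–(4)] -/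
theorem groundEnergy_hubbardRectTorusTT'_ge_of_sector_certificate (La Lb : ℕ) (t t' U : ℝ) {nh : ℕ}
    (hn : nh ≤ La * Lb)
    {m : Type*} [Fintype m] [DecidableEq m] {Λm : Matrix m m ℂ} (hΛm : Λm.PosSemidef)
    (O : m → Matrix (Finset (Orb (Fin La ×ₗ Fin Lb))) (Finset (Orb (Fin La ×ₗ Fin Lb))) ℂ)
    {κ : Type*} (s : Finset κ)
    (Xc : κ → Matrix (Finset (Orb (Fin La ×ₗ Fin Lb))) (Finset (Orb (Fin La ×ₗ Fin Lb))) ℂ)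
    {ι : Type*} (tt : Finset ι)
    (Us Y : ι → Matrix (Finset (Orb (Fin La ×ₗ Fin Lb))) (Finset (Orb (Fin La ×ₗ Fin Lb))) ℂ)
    (hU : ∀ l ∈ tt, Us l * hubbardRectTorusTT' La Lb t t' U = hubbardRectTorusTT' La Lb t t' U * Us l)
    (hUK : ∀ l ∈ tt, ∀ ψ ∈ (szSector (2 * nh) 0 : Submodule ℂ (Fock (Orb (Fin La ×ₗ Fin Lb)))),
      Us l *ᵥ ψ ∈ (szSector (2 * nh) 0 : Submodule ℂ (Fock (Orb (Fin La ×ₗ Fin Lb)))))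
    (hUK' : ∀ l ∈ tt, ∀ ψ ∈ (szSector (2 * nh) 0 : Submodule ℂ (Fock (Orb (Fin La ×ₗ Fin Lb)))),
      (Us l)ᴴ *ᵥ ψ ∈ (szSector (2 * nh) 0 : Submodule ℂ (Fock (Orb (Fin La ×ₗ Fin Lb)))))
    (hUU : ∀ l ∈ tt, (Us l)ᴴ * Us l = 1)
    {ρ : Type*} (r : Finset ρ)
    (Z Z' : ρ → Matrix (Finset (Orb (Fin La ×ₗ Fin Lb))) (Finset (Orb (Fin La ×ₗ Fin Lb))) ℂ)
    {ρ' : Type*} (r' : Finset ρ')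
    (S S' : ρ' → Matrix (Finset (Orb (Fin La ×ₗ Fin Lb))) (Finset (Orb (Fin La ×ₗ Fin Lb))) ℂ)
    {ρ'' : Type*} (u : Finset ρ'') (b : ρ'' → ℂ) (cw : ρ'' → List (Orb (Fin La ×ₗ Fin Lb) × Bool))
    (hcw : ∀ j ∈ u, ladderCharge (cw j) ≠ 0 ∨ ladderSpinCharge (cw j) ≠ 0)
    {δ : Type*} (ah : Finset δ) (dc : δ → ℝ)
    (V : δ → Matrix (Finset (Orb (Fin La ×ₗ Fin Lb))) (Finset (Orb (Fin La ×ₗ Fin Lb))) ℂ)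
    {κ'' : Type*} (w : Finset κ'') (a : κ'' → ℂ) (word : κ'' → List (Orb (Fin La ×ₗ Fin Lb) × Bool))
    {c : ℝ}
    (hcert : hubbardRectTorusTT' La Lb t t' U -
        (c : ℂ) • (1 : Matrix (Finset (Orb (Fin La ×ₗ Fin Lb))) (Finset (Orb (Fin La ×ₗ Fin Lb))) ℂ) =
      gramForm Λm O +
        (∑ k ∈ s, (hubbardRectTorusTT' La Lb t t' U * Xc k - Xc k * hubbardRectTorusTT' La Lb t t' U) +
          ∑ l ∈ tt, (Us l * Y l * (Us l)ᴴ - Y l) +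
          ∑ i ∈ r, (Z i * (totalNumber - ((2 * nh : ℕ) : ℂ) • 1) +
            (totalNumber - ((2 * nh : ℕ) : ℂ) • 1) * Z' i) +
          ∑ i ∈ r', (S i * HubbardWave0.spinZ + HubbardWave0.spinZ * S' i) +
          ∑ j ∈ u, b j • ladderWord (cw j)) +
        (∑ m' ∈ ah, ((dc m' : ℝ) : ℂ) • ((V m')ᴴ - V m') + ∑ k ∈ w, a k • ladderWord (word k))) :
    c - ∑ k ∈ w, ‖a k‖ ≤ groundEnergy (hubbardRectTorusTT' La Lb t t' U) (2 * nh) := by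
  have hn' : nh ≤ Fintype.card (Fin La ×ₗ Fin Lb) := by rw [card_rectSites]; exact hn
  -- the `2n`-particle ground energy is attained at `S^z = 0` (Lieb), and that sector is non-trivial
  have hE : groundEnergy (hubbardRectTorusTT' La Lb t t' U) (2 * nh) =
      (hubbardRectTorusTT' La Lb t t' U).minEnergyOn (szSector (2 * nh) 0) :=
    groundEnergy_hamiltonian₂_eq_minEnergyOn_szSector _ _ t t' U hn'
  have hK : (szSector (2 * nh) 0 : Submodule ℂ (Fock (Orb (Fin La ×ₗ Fin Lb)))) ≠ ⊥ := by
    obtain ⟨⟨ψ, hψK, hψ0, -⟩, -⟩ := szSector_groundState (fermionRectTorusGraph La Lb) t U hn'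
    exact (Submodule.ne_bot_iff _).2 ⟨ψ, hψK, hψ0⟩
  have hS : Commute (hubbardRectTorusTT' La Lb t t' U) HubbardWave0.spinZ :=
    ((hamiltonian_isHermitian_and_commute_holds (fermionRectTorusGraph La Lb) t U).2.2).add_left
      ((hamiltonian_isHermitian_and_commute_holds (fermionRectTorusDiagGraph La Lb) t' 0).2.2)
  rw [hE]
  refine minEnergyOn_szSector_ge_of_sector_certificate (hubbardRectTorusTT' La Lb t t' U)
    (hubbardRectTorusTT'_isHermitian La Lb t t' U) (hubbardRectTorusTT'_commute_totalNumber La Lb t t' U)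
    hS hK hΛm O s Xc tt Us Y hU hUK hUK' hUU r Z Z' r' S S' u b cw hcw ah dc V w a word ?_
  simpa only [Complex.ofReal_zero, zero_smul, sub_zero] using hcert

end Rect

end Literature.MathematicalPhysics.QuantumLattice

end
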